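import Summits.HodgeConjecture.HodgeConjecture.Theorems.MarkmanPartnerTransportPicardThreeK3SquaresTransportAlongCorrespondenceIff
import Literature.AlgebraicGeometry.Surfaces.GeometricGenusOneAssociatedK3Surface

/-!
# Route MarkmanPartnerTransport · crux #4 `PicardThreeK3Squares` (stmt-HodgeConjecture-19652) — HC⁴ OF THE SQUARE IS
# INVARIANT UNDER MORRISON ISOGENIES REALISED BY ALGEBRAIC CYCLES (UNCONDITIONAL), in the Literature's vocabulary

Morrison (Tokyo J. Math. 10 (1987)): surfaces `X`, `Y` with `p_g = 1` are ISOGENOUS when an algebraic cycle on `X × Y`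
induces an isomorphism of rational Hodge structures `T(X, ℚ) ⥲ T(Y, ℚ)`; every surface with `p_g = 1` is
cohomologically isogenous to a K3 surface (its associated K3), and the open point (Fu–Laterveer–Vial 2019, Rem. 7.8) is
whether that isogeny is induced by a cycle. In the tree's carriers (`Surfaces.HasGeometricGenusOne`,
`Surfaces.IsCohomologicalIsogeny`, `Surfaces.IsCycleInducedOnTranscendental` of
`Literature/AlgebraicGeometry/Surfaces/GeometricGenusOneAssociatedK3Surface`):

* `hodgeConjectureFor_square_iff_of_isCycleInducedOnTranscendental` — **for smooth projective surfaces `X`, `Y` of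
  geometric genus one and a cohomological isogeny `g : T(X) ⥲ T(Y)` which is CYCLE-INDUCED on `T(X)` (modulo `N¹(Y)`),
  `HodgeConjectureFor 4 (X ⊗ X) ↔ HodgeConjectureFor 4 (Y ⊗ Y)`** — NO named fact: the inducing correspondence does not
  kill the period (`g σ ≠ 0` is of type `(2,0)`, the defect is of type `(1,1)`), so
  `SquareTransport.hodgeConjectureFor_square_iff_of_algebraicCorrespondence₂` applies;
* `hodgeConjectureFor_square_iff_of_isogeny_K3` — the same with `Y` a K3 surface (e.g. Morrison's associated K3).

So HC⁴ of the square of a `p_g = 1` surface (Todorov, Kunev, Catanese surfaces, K3 covers, …) is EQUIVALENT to HC⁴ of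
the square of any K3 surface it is cycle-isogenous to; in particular it HOLDS as soon as that K3 lies in a known
sector (CM, `End = ℚ`, `ρ ≥ 17`, the van Geemen–Schütt families, …). THEOREMS ONLY; no sorry, no definition, no named
fact; nothing here says the crux or HC is proved. Prover seat hodge-nonav-19652-p1 (gen 16),
`--supports stmt-HodgeConjecture-19652`.

References: D. R. Morrison, Tokyo J. Math. 10 (1987) 179–187, §1 Definition, Thm. 1 (i), p. 182; L. Fu, R. Laterveer,
Ch. Vial, arXiv:1911.06580 Rem. 7.8; C. Voisin, *Hodge Theory I* Lemma 11.41.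
-/

set_option linter.dupNamespace false

noncomputable section

namespace Summit.HodgeConjecture.HodgeConjecture.Theorems.MarkmanPartnerTransport.SquareTransport

open CategoryTheory MonoidalCategory Literature.AlgebraicGeometry Literature.AlgebraicGeometry.Motives
open Literature.AlgebraicGeometry.HodgeTheory Literature.AlgebraicTopology.SingularHomology
open Literature.AlgebraicGeometry.Surfaces
open Summit.HodgeConjecture.HodgeConjecture.Theorems.NikulinTwinTransport
open Summit.HodgeConjecture.HodgeConjecture.Theorems.MarkmanPartnerTransport.KugaSatakeSelf
open Summit.HodgeConjecture.HodgeConjecture.Theorems.MarkmanPartnerTransport.KugaSatakeMixed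

variable {X Y : SchemeOver ℂ}

/-- **HC⁴(X ⊗ X) ⟺ HC⁴(Y ⊗ Y) along a CYCLE-INDUCED cohomological isogeny of surfaces of geometric genus one**
(Morrison's isogenies realised by algebraic cycles) — UNCONDITIONAL. The inducing algebraic correspondence `T` has
`T σ = g σ + n` with `g σ ≠ 0` of type `(2,0)` and `n ∈ N¹(Y)` of type `(1,1)`, so `T σ ≠ 0` and
`hodgeConjectureFor_square_iff_of_algebraicCorrespondence₂` applies. [cite: Morrison1987Isogenies, §1 Definition (p. 181) and p. 182]
[cite: VoisinHodgeI2002, Lemma 11.41] -/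
theorem hodgeConjectureFor_square_iff_of_isCycleInducedOnTranscendental
    (hX : IsSmoothProjective 2 X) (hpX : HasGeometricGenusOne X)
    (hY : IsSmoothProjective 2 Y) (hpY : HasGeometricGenusOne Y)
    {g : complexBetti X (2 * 1) →ₗ[ℂ] complexBetti Y (2 * 1)} (hg : IsCohomologicalIsogeny X Y g)
    (hcyc : IsCycleInducedOnTranscendental X Y g) :
    HodgeConjectureFor 4 (X ⊗ X) ↔ HodgeConjectureFor 4 (Y ⊗ Y) := by
  obtain ⟨σ, hσ0, hσ, hline⟩ := hpX
  obtain ⟨σ', hσ'0, hσ', hline'⟩ := hpY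
  obtain ⟨T, hT, hTg⟩ := hcyc
  have hσtr : σ ∈ transcendentalSubspace X :=
    (mem_transcendentalSubspace_iff_forall_algebraicClasses hX σ).2 (transc_of_twoZero hX hσ)
  have hgσ : IsOfHodgeType 2 Y (2 * 1) 2 0 (g σ) := hg.isOfHodgeType_map hσtr hσ
  have hgσ0 : g σ ≠ 0 := fun h0 =>
    hσ0 (hg.bijOn.injOn hσtr (Submodule.zero_mem _) (by rw [h0, map_zero]))
  have hTσ : T σ ≠ 0 := by
    intro h0
    have hn : T σ - g σ ∈ algebraicClasses Y 1 := hTg σ hσtr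
    rw [h0, zero_sub, Submodule.neg_mem_iff] at hn
    exact hgσ0 (IsOfHodgeType.eq_zero_of_ne hY hgσ
      (isOfHodgeType_of_mem_algebraicClasses_of_isSmoothProjective hY 1 hn) (by decide))
  exact hodgeConjectureFor_square_iff_of_algebraicCorrespondence₂ hX hσ hσ0 hline hY hσ' hσ'0 hline' T hT hTσ

/-- **HC⁴(X ⊗ X) ⟺ HC⁴(Y ⊗ Y) for a surface `X` of geometric genus one CYCLE-ISOGENOUS to a K3 surface `Y`** (e.g.
Morrison's associated K3 surface, when the isogeny of his Thm. 1 (i) is realised by an algebraic cycle) — UNCONDITIONAL.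
[cite: Morrison1987Isogenies, §2 Thm. 1 (i) and §1 p. 182] [cite: Huybrechts2016K3, Ch. 1 §2.4] -/
theorem hodgeConjectureFor_square_iff_of_isogeny_K3
    (hX : IsSmoothProjective 2 X) (hpX : HasGeometricGenusOne X) (hY : IsK3Surface Y)
    {g : complexBetti X (2 * 1) →ₗ[ℂ] complexBetti Y (2 * 1)} (hg : IsCohomologicalIsogeny X Y g)
    (hcyc : IsCycleInducedOnTranscendental X Y g) :
    HodgeConjectureFor 4 (X ⊗ X) ↔ HodgeConjectureFor 4 (Y ⊗ Y) :=
  hodgeConjectureFor_square_iff_of_isCycleInducedOnTranscendental hX hpX hY.isSmoothProjective hY.hasGeometricGenusOne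
    hg hcyc

end Summit.HodgeConjecture.HodgeConjecture.Theorems.MarkmanPartnerTransport.SquareTransport

end
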